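import Summits.KontsevichZagierPeriods.KontsevichZagierPeriods.Theorems.TerasomaMultiplicationBetaCancellationOfAyoubPiCancellation
import Summits.KontsevichZagierPeriods.KontsevichZagierPeriods.Theorems.AyoubPiLocalKernel.Negative.LoadBearing
import Summits.KontsevichZagierPeriods.KontsevichZagierPeriods.Theorems.MzvKernelInKZ.Negative.ScalingDivision
import Literature.NumberTheory.Transcendental.KZLogCalculusProofs
import Literature.NumberTheory.Transcendental.KZCalculusProofs
import Literature.NumberTheory.Transcendental.KZRulesAssociator

/-!
# `AyoubPiCancellation` (stmt-KontsevichZagierPeriods-0540) — negative knowledge I: load-bearing hypotheses, degenerate paddings, refuted strengthenings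

The crux (routes HyperbolicBloch / AyoubSpecialisation / KatzTower / LiouvilleUnfolding / … ; in
closed form `KZ.PiCancellation`, `BetaCancellationLine.stub_ayoubBridge`) reads: for every PINNED
family `P n r = [unit disc] × r` (disc in the two leading coordinates of `Fin (n + 2)`, integrand of
the trailing ones) and every formal combination `c`, `lift (of ∘ P) c ∈ relations → c ∈ relations`.
cdisprove (refuter) lemmas, each the crux VERBATIM with one hypothesis deleted or one constant
mutated (inlined, no new `Prop`), sorry-free, axioms ⊆ {propext, Classical.choice, Quot.sound}:

* §0 STRUCTURE: the converse implication is a theorem (`lift_mem_relations_of_mem`, ideal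
  property), so the crux is an `iff` per element (`ayoubPiCancellation_iff_forall_iff`); `∀ P`
  ranges over exactly one object (`ayoubPiCancellation_iff_exists`); soundness side
  `eval_eq_zero_of_lift_mem` (every counterexample lies in `ker eval ∖ relations`, i.e. is a
  counterexample to Conjecture 1 — the crux is implied by the summit,
  `LiouvilleUnfolding.PiLocalisation.ayoubPiCancellation_of_summit`).
* §1 LOAD-BEARING: `ayoubPiCancellation_false_without_pinning` (any family `P`: FALSE, witness the
  empty family — contrast 0541, where the same deletion gives back the summit),
  `_false_without_domainClause` (domain `∅`), `_false_without_integrandClause` (integrand `0`).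
* §2 DEGENERATE PADDINGS: radius `0` is FALSE (`_false_at_radius_zero`, null padding); no disc at
  all makes the pinning UNSATISFIABLE (`noDisc_unsatisfiable`, `1 ∉ L¹(ℝ²)`), so that mutation is
  VACUOUSLY true (`noDisc_vacuous`).
* §3 REFUTED STRENGTHENINGS: conclusion `c = 0` (`not_lift_mem_imp_eq_zero`); padding by ANY family
  of relations never cancels (`noCancellation_of_padding_mem_relations`).
* Companion file `Negative/Boundary.lean`: §4 BOUNDARY (commensurable paddings cancel; the unit
  square cancels; `[π]` is incommensurable with `1`) and §5 PROVABLE CASE (non-negative generators).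
[cite: KontsevichZagierPeriods2001, §1.2 Conjecture 1 and §4.1] [cite: HuberWustholz2022, App. A.4]
-/

noncomputable section

open MeasureTheory Set
open Literature.NumberTheory.Transcendental
open Literature.NumberTheory.Transcendental.KZ
open Literature.ModelTheory.ExponentialFields (IsSemialgebraic isSemialgebraic_univ
  isSemialgebraic_empty)

namespace Summit.KontsevichZagierPeriods.AyoubPiCancellationNegative

-- the item's decl in its home route; the decls `HyperbolicBloch.AyoubPiCancellation`,
-- `LiouvilleUnfolding.AyoubPiCancellation`, … of the other routes wanting 0540 are syntactically
-- identical (`Iff.rfl`)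
open Summit.KontsevichZagierPeriods.KontsevichZagierPeriods.Theses.AyoubSpecialisation
  (AyoubPiCancellation)
open Summit.KontsevichZagierPeriods.KontsevichZagierPeriods.BetaCancellationLine
  (exists_pinned piRep_mul_sub_lift_mem_relations lift_mem_relations_iff
    pinned_eq_piRep_prod_reindex piIndex_castAdd_zero piIndex_castAdd_one piIndex_natAdd)
open Summit.KontsevichZagierPeriods.LiouvilleUnfolding.AyoubPiLocalKernelNegative
  (eval_lift of_slab_slab_sub_mem pinned_unique)
open Summit.KontsevichZagierPeriods.MzvKernelInKZ.Negative (mem_relations_of_nsmul_mem)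

/-! ## §0 Dictionary, soundness side, structure -/

-- Dictionary (landed, not restated): `AyoubPiCancellation ↔ KZ.PiCancellation` is
-- `BetaCancellationLine.stub_ayoubBridge` /
-- `LiouvilleUnfolding.PiLocalKernelPosition.ayoubPiCancellation_iff_piCancellation`.

/-- If every `[P n r]` is a relation then `lift (of ∘ P)` maps EVERYTHING into relations (used by
all junk witnesses below). [folklore] -/
theorem lift_mem_relations_of_forall {d : ℕ} (P : ∀ n : ℕ, IntegralRep n → IntegralRep (n + d))
    (hP : ∀ (n : ℕ) (r : IntegralRep n), of (P n r) ∈ relations) (c : FormalRep) :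
    FreeAbelianGroup.lift (fun s : (Σ n, IntegralRep n) => of (P s.1 s.2)) c ∈ relations := by
  induction c using FreeAbelianGroup.induction_on with
  | zero => simp [relations.zero_mem]
  | of s =>
    rw [FreeAbelianGroup.lift_apply_of]
    exact hP s.1 s.2
  | neg s ih =>
    rw [map_neg]
    exact relations.neg_mem ih
  | add x y hx hy =>
    rw [map_add]
    exact relations.add_mem hx hy

/-- **Soundness side**: `lift (of ∘ P) c ∈ relations → eval c = 0` for the pinned family, so
every counterexample to the crux lies in `ker eval ∖ relations`. [folklore] -/
theorem eval_eq_zero_of_lift_mem (P : ∀ n : ℕ, IntegralRep n → IntegralRep (n + 2))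
    (hP : ∀ (n : ℕ) (r : IntegralRep n),
      (P n r).domain = {z : Fin (n + 2) → ℝ | z 0 ^ 2 + z 1 ^ 2 ≤ 1 ∧
          (fun i : Fin n => z i.succ.succ) ∈ r.domain} ∧
        (P n r).integrand = fun z => r.integrand (fun i : Fin n => z i.succ.succ))
    {c : FormalRep}
    (h : FreeAbelianGroup.lift (fun s : (Σ n, IntegralRep n) => of (P s.1 s.2)) c ∈ relations) :
    eval c = 0 := by
  have h0 : eval (FreeAbelianGroup.lift (fun s : (Σ n, IntegralRep n) => of (P s.1 s.2)) c) = 0 :=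
    relations_le_ker_eval_holds h
  rw [eval_lift P hP] at h0
  exact (mul_eq_zero.mp h0).resolve_left Real.pi_ne_zero

/-- **The converse implication of the crux is a theorem**: `c ∈ relations → lift (of ∘ P) c ∈
relations` (relations form an ideal under the Fubini product, `KZ.piRep_mul_mem_relations`, and
`lift (of ∘ P) ≡ [π] * ·`). [folklore] -/
theorem lift_mem_relations_of_mem (P : ∀ n : ℕ, IntegralRep n → IntegralRep (n + 2))
    (hP : ∀ (n : ℕ) (r : IntegralRep n),
      (P n r).domain = {z : Fin (n + 2) → ℝ | z 0 ^ 2 + z 1 ^ 2 ≤ 1 ∧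
          (fun i : Fin n => z i.succ.succ) ∈ r.domain} ∧
        (P n r).integrand = fun z => r.integrand (fun i : Fin n => z i.succ.succ))
    {c : FormalRep} (hc : c ∈ relations) :
    FreeAbelianGroup.lift (fun s : (Σ n, IntegralRep n) => of (P s.1 s.2)) c ∈ relations :=
  (lift_mem_relations_iff P hP c).2 (piRep_mul_mem_relations hc)

/-- The crux per element is an `iff`: `AyoubPiCancellation ↔ ∀ P pinned, ∀ c,
(lift (of ∘ P) c ∈ relations ↔ c ∈ relations)`. [folklore] -/
theorem ayoubPiCancellation_iff_forall_iff :
    AyoubPiCancellation ↔ ∀ P : ∀ n : ℕ, IntegralRep n → IntegralRep (n + 2),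
      (∀ (n : ℕ) (r : IntegralRep n),
        (P n r).domain = {z : Fin (n + 2) → ℝ | z 0 ^ 2 + z 1 ^ 2 ≤ 1 ∧
            (fun i : Fin n => z i.succ.succ) ∈ r.domain} ∧
          (P n r).integrand = fun z => r.integrand (fun i : Fin n => z i.succ.succ)) →
      ∀ c : FormalRep,
        (FreeAbelianGroup.lift (fun s : (Σ n, IntegralRep n) => of (P s.1 s.2)) c ∈ relations ↔
          c ∈ relations) := by
  refine forall₂_congr fun P hP => forall_congr' fun c => ?_
  exact ⟨fun h => ⟨h, lift_mem_relations_of_mem P hP⟩, fun h => h.1⟩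

/-- `∀ P pinned` ranges over exactly one object: the crux is equivalent to its `∃ P` form
(`BetaCancellationLine.exists_pinned`, `AyoubPiLocalKernelNegative.pinned_unique`). [folklore] -/
theorem ayoubPiCancellation_iff_exists :
    AyoubPiCancellation ↔ ∃ P : ∀ n : ℕ, IntegralRep n → IntegralRep (n + 2),
      (∀ (n : ℕ) (r : IntegralRep n),
        (P n r).domain = {z : Fin (n + 2) → ℝ | z 0 ^ 2 + z 1 ^ 2 ≤ 1 ∧
            (fun i : Fin n => z i.succ.succ) ∈ r.domain} ∧
          (P n r).integrand = fun z => r.integrand (fun i : Fin n => z i.succ.succ)) ∧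
      ∀ c : FormalRep,
        FreeAbelianGroup.lift (fun s : (Σ n, IntegralRep n) => of (P s.1 s.2)) c ∈ relations →
          c ∈ relations := by
  constructor
  · intro h
    obtain ⟨P, hP⟩ := exists_pinned
    exact ⟨P, hP, h P hP⟩
  · rintro ⟨P, hP, h⟩ P' hP' c hc
    rw [← pinned_unique hP hP'] at hc
    exact h c hc

/-! ## §1 LOAD-BEARING HYPOTHESES: both clauses of the pinning -/

/-- **Any proof must use the pinning**: the crux VERBATIM with the pinning hypothesis deleted
(any family `P : ∀ n, IntegralRep n → IntegralRep (n + 2)`) is FALSE. Witness: the empty family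
`P n r := [∅] ∈ relations`, `c := [π]` (value `π ≠ 0`). (For the sibling crux 0541 the same
deletion gives back the summit — `AyoubPiLocalKernelNegative.withoutPinning_iff_kzKernelConjecture`;
here it is plainly false.) [folklore] -/
theorem ayoubPiCancellation_false_without_pinning :
    ¬ ∀ (P : ∀ n : ℕ, IntegralRep n → IntegralRep (n + 2)) (c : FormalRep),
      FreeAbelianGroup.lift (fun s : (Σ n, IntegralRep n) => of (P s.1 s.2)) c ∈ relations →
        c ∈ relations := by
  intro h
  have hmem : of piRep ∈ relations :=
    h (fun n _ => IntegralRep.empty (n + 2)) (of piRep)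
      (lift_mem_relations_of_forall _ (fun n _ => IntegralRep.of_empty_mem_relations) _)
  have h0 : eval (of piRep) = 0 := relations_le_ker_eval_holds hmem
  rw [eval_of_piRep] at h0
  exact Real.pi_ne_zero h0

/-- **Any proof must use the DOMAIN clause of the pinning**: the crux with only the integrand
pinned is FALSE. Witness: `P n r :=` the pinned representation restricted to `∅` (same integrand,
null domain, a relation), `c := [π]`. [folklore] -/
theorem ayoubPiCancellation_false_without_domainClause :
    ¬ ∀ P : ∀ n : ℕ, IntegralRep n → IntegralRep (n + 2),
      (∀ (n : ℕ) (r : IntegralRep n),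
        (P n r).integrand = fun z => r.integrand (fun i : Fin n => z i.succ.succ)) →
      ∀ c : FormalRep,
        FreeAbelianGroup.lift (fun s : (Σ n, IntegralRep n) => of (P s.1 s.2)) c ∈ relations →
          c ∈ relations := by
  intro h
  obtain ⟨P₀, hP₀⟩ := exists_pinned
  let P : ∀ n : ℕ, IntegralRep n → IntegralRep (n + 2) := fun n r =>
    (P₀ n r).restrict ∅ isSemialgebraic_empty (empty_subset _)
  have hP : ∀ (n : ℕ) (r : IntegralRep n),
      (P n r).integrand = fun z => r.integrand (fun i : Fin n => z i.succ.succ) :=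
    fun n r => (hP₀ n r).2
  have hrel : ∀ (n : ℕ) (r : IntegralRep n), of (P n r) ∈ relations := fun n r =>
    of_mem_relations_of_volume_eq_zero _ (by simp [P, IntegralRep.restrict])
  have hmem : of piRep ∈ relations :=
    h P hP (of piRep) (lift_mem_relations_of_forall P hrel _)
  have h0 : eval (of piRep) = 0 := relations_le_ker_eval_holds hmem
  rw [eval_of_piRep] at h0
  exact Real.pi_ne_zero h0

/-- **Any proof must use the INTEGRAND clause of the pinning**: the crux with only the domain
pinned is FALSE. Witness: `P n r :=` the zero representation on the pinned domain (a relation),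
`c := [π]`. [folklore] -/
theorem ayoubPiCancellation_false_without_integrandClause :
    ¬ ∀ P : ∀ n : ℕ, IntegralRep n → IntegralRep (n + 2),
      (∀ (n : ℕ) (r : IntegralRep n),
        (P n r).domain = {z : Fin (n + 2) → ℝ | z 0 ^ 2 + z 1 ^ 2 ≤ 1 ∧
            (fun i : Fin n => z i.succ.succ) ∈ r.domain}) →
      ∀ c : FormalRep,
        FreeAbelianGroup.lift (fun s : (Σ n, IntegralRep n) => of (P s.1 s.2)) c ∈ relations →
          c ∈ relations := by
  intro h
  obtain ⟨P₀, hP₀⟩ := exists_pinned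
  have hz : ∀ (n : ℕ) (r : IntegralRep n), ∃ z : IntegralRep (n + 2),
      z.domain = (P₀ n r).domain ∧ z.integrand = 0 :=
    fun n r => exists_zeroRep (P₀ n r).isSemialgebraic_domain
  choose P hPd hPi using hz
  have hP : ∀ (n : ℕ) (r : IntegralRep n),
      (P n r).domain = {z : Fin (n + 2) → ℝ | z 0 ^ 2 + z 1 ^ 2 ≤ 1 ∧
          (fun i : Fin n => z i.succ.succ) ∈ r.domain} :=
    fun n r => (hPd n r).trans (hP₀ n r).1
  have hrel : ∀ (n : ℕ) (r : IntegralRep n), of (P n r) ∈ relations := fun n r =>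
    of_mem_relations_of_eqOn_zero _ (by rw [hPi]; exact fun _ _ => rfl)
  have hmem : of piRep ∈ relations :=
    h P hP (of piRep) (lift_mem_relations_of_forall P hrel _)
  have h0 : eval (of piRep) = 0 := relations_le_ker_eval_holds hmem
  rw [eval_of_piRep] at h0
  exact Real.pi_ne_zero h0

/-! ## §2 DEGENERATE AND LIMIT PARAMETERS of the disc -/

/-- The degenerate disc `{z 0 ^ 2 + z 1 ^ 2 ≤ 0} × σ` is Lebesgue-null (it lies in the coordinate
hyperplane `z 0 = 0`). [folklore] -/
theorem volume_radiusZero_eq_zero {n : ℕ} (σ : Set (Fin n → ℝ)) :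
    volume {z : Fin (n + 2) → ℝ | z 0 ^ 2 + z 1 ^ 2 ≤ 0 ∧ (fun i : Fin n => z i.succ.succ) ∈ σ} = 0 := by
  refine measure_mono_null (t := Set.pi univ (fun i : Fin (n + 2) => if i = 0 then ({0} : Set ℝ) else univ))
    ?_ ?_
  · intro z hz
    simp only [mem_pi, mem_univ, true_implies]
    intro i
    split_ifs with hi
    · subst hi
      have h := hz.1
      have h0 : z 0 ^ 2 = 0 := by nlinarith [sq_nonneg (z 0), sq_nonneg (z 1)]
      simpa using h0
    · exact mem_univ _
  · rw [volume_pi_pi]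
    exact Finset.prod_eq_zero (Finset.mem_univ 0) (by simp)

/-- **Radius `0` is FALSE** (the limit `ρ → 0` of the padding disc): the crux with the unit disc
replaced by the degenerate disc `z 0 ^ 2 + z 1 ^ 2 ≤ 0` is false — a null padding sends everything
into relations. Witness: the pinned family restricted to the degenerate disc, `c := [π]`. The
padding must have POSITIVE measure. [folklore] -/
theorem ayoubPiCancellation_false_at_radius_zero :
    ¬ ∀ P : ∀ n : ℕ, IntegralRep n → IntegralRep (n + 2),
      (∀ (n : ℕ) (r : IntegralRep n),
        (P n r).domain = {z : Fin (n + 2) → ℝ | z 0 ^ 2 + z 1 ^ 2 ≤ 0 ∧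
            (fun i : Fin n => z i.succ.succ) ∈ r.domain} ∧
          (P n r).integrand = fun z => r.integrand (fun i : Fin n => z i.succ.succ)) →
      ∀ c : FormalRep,
        FreeAbelianGroup.lift (fun s : (Σ n, IntegralRep n) => of (P s.1 s.2)) c ∈ relations →
          c ∈ relations := by
  intro h
  obtain ⟨P₀, hP₀⟩ := exists_pinned
  -- the degenerate disc × σ, as a semialgebraic subset of the pinned domain
  have hsa : ∀ (n : ℕ) (r : IntegralRep n), IsSemialgebraic ℚ
      {z : Fin (n + 2) → ℝ | z 0 ^ 2 + z 1 ^ 2 ≤ 0 ∧ (fun i : Fin n => z i.succ.succ) ∈ r.domain} := by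
    intro n r
    have h1 : IsSemialgebraic ℚ {z : Fin (n + 2) → ℝ | z 0 ^ 2 + z 1 ^ 2 ≤ 0} := by
      have h := Literature.ModelTheory.ExponentialFields.isSemialgebraic_setOf_eval_le (k := ℚ)
        (R := ℝ) ((MvPolynomial.X 0) ^ 2 + (MvPolynomial.X 1) ^ 2 : MvPolynomial (Fin (n + 2)) ℚ) 0
      simp only [map_add, map_pow, MvPolynomial.aeval_X, map_zero] at h
      exact h
    have h2 := (P₀ n r).isSemialgebraic_domain
    rw [(hP₀ n r).1] at h2
    have hset : {z : Fin (n + 2) → ℝ | z 0 ^ 2 + z 1 ^ 2 ≤ 0 ∧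
        (fun i : Fin n => z i.succ.succ) ∈ r.domain} =
        {z : Fin (n + 2) → ℝ | z 0 ^ 2 + z 1 ^ 2 ≤ 0} ∩
          {z : Fin (n + 2) → ℝ | z 0 ^ 2 + z 1 ^ 2 ≤ 1 ∧
            (fun i : Fin n => z i.succ.succ) ∈ r.domain} := by
      ext z
      simp only [mem_setOf_eq, mem_inter_iff]
      constructor
      · rintro ⟨hz, hσ⟩
        exact ⟨hz, by nlinarith [sq_nonneg (z 0), sq_nonneg (z 1)], hσ⟩
      · rintro ⟨hz, -, hσ⟩
        exact ⟨hz, hσ⟩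
    rw [hset]
    exact h1.inter h2
  have hsub : ∀ (n : ℕ) (r : IntegralRep n),
      {z : Fin (n + 2) → ℝ | z 0 ^ 2 + z 1 ^ 2 ≤ 0 ∧ (fun i : Fin n => z i.succ.succ) ∈ r.domain} ⊆
        (P₀ n r).domain := by
    intro n r z hz
    rw [(hP₀ n r).1]
    exact ⟨by nlinarith [hz.1, sq_nonneg (z 0), sq_nonneg (z 1)], hz.2⟩
  let P : ∀ n : ℕ, IntegralRep n → IntegralRep (n + 2) := fun n r =>
    (P₀ n r).restrict _ (hsa n r) (hsub n r)
  have hP : ∀ (n : ℕ) (r : IntegralRep n),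
      (P n r).domain = {z : Fin (n + 2) → ℝ | z 0 ^ 2 + z 1 ^ 2 ≤ 0 ∧
          (fun i : Fin n => z i.succ.succ) ∈ r.domain} ∧
        (P n r).integrand = fun z => r.integrand (fun i : Fin n => z i.succ.succ) :=
    fun n r => ⟨rfl, (hP₀ n r).2⟩
  have hrel : ∀ (n : ℕ) (r : IntegralRep n), of (P n r) ∈ relations := fun n r =>
    of_mem_relations_of_volume_eq_zero _ (volume_radiusZero_eq_zero r.domain)
  have hmem : of piRep ∈ relations :=
    h P hP (of piRep) (lift_mem_relations_of_forall P hrel _)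
  have h0 : eval (of piRep) = 0 := relations_le_ker_eval_holds hmem
  rw [eval_of_piRep] at h0
  exact Real.pi_ne_zero h0

/-- Lebesgue measure of `ℝ²` (as `Fin 2 → ℝ`-indexed coordinates of `Fin (0 + 2) → ℝ`) is
infinite. [folklore] -/
theorem volume_univ_fin_two : volume (univ : Set (Fin (0 + 2) → ℝ)) = ⊤ := by
  rw [volume_pi, Measure.pi_univ]
  simp

/-- **No disc at all: the pinning becomes UNSATISFIABLE.** Padding by the whole plane `ℝ²`
(the limit `ρ → ∞`): no family `P` has `(P 0 [pt, 1]).domain = ℝ²` with integrand `1`, because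
`1 ∉ L¹(ℝ²)` while `IntegralRep` demands absolute integrability. [folklore] -/
theorem noDisc_unsatisfiable :
    ¬ ∃ P : ∀ n : ℕ, IntegralRep n → IntegralRep (n + 2),
      ∀ (n : ℕ) (r : IntegralRep n),
        (P n r).domain = {z : Fin (n + 2) → ℝ | (fun i : Fin n => z i.succ.succ) ∈ r.domain} ∧
          (P n r).integrand = fun z => r.integrand (fun i : Fin n => z i.succ.succ) := by
  rintro ⟨P, hP⟩
  have hd : (P 0 IntegralRep.unit).domain = univ := by
    rw [(hP 0 IntegralRep.unit).1]
    ext z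
    simp
  have hi : (P 0 IntegralRep.unit).integrand = fun _ => 1 := by
    rw [(hP 0 IntegralRep.unit).2]
    rfl
  have hint := (P 0 IntegralRep.unit).integrableOn
  rw [hd, hi, integrableOn_const_iff] at hint
  rcases hint with h | h
  · simp at h
  · rw [volume_univ_fin_two] at h
    exact lt_irrefl _ h

/-- Hence the crux with the disc constraint DELETED is VACUOUSLY TRUE (true for the wrong reason):
finiteness of the padding measure is used through the very typing of `IntegralRep`. [folklore] -/
theorem noDisc_vacuous :
    ∀ P : ∀ n : ℕ, IntegralRep n → IntegralRep (n + 2),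
      (∀ (n : ℕ) (r : IntegralRep n),
        (P n r).domain = {z : Fin (n + 2) → ℝ | (fun i : Fin n => z i.succ.succ) ∈ r.domain} ∧
          (P n r).integrand = fun z => r.integrand (fun i : Fin n => z i.succ.succ)) →
      ∀ c : FormalRep,
        FreeAbelianGroup.lift (fun s : (Σ n, IntegralRep n) => of (P s.1 s.2)) c ∈ relations →
          c ∈ relations :=
  fun P hP => absurd ⟨P, hP⟩ noDisc_unsatisfiable

/-! ## §3 REFUTED STRENGTHENINGS -/

/-- A generator of the free abelian group `FormalRep` is not `0`. [folklore] -/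
theorem of_ne_zero {n : ℕ} (r : IntegralRep n) : of r ≠ 0 := by
  intro h
  have := congrArg (FreeAbelianGroup.lift (fun _ : (Σ n, IntegralRep n) => (1 : ℤ))) h
  rw [of, FreeAbelianGroup.lift_apply_of, map_zero] at this
  exact one_ne_zero this

/-- **Strengthening the conclusion to `c = 0` is FALSE**: `lift (of ∘ P)` is injective on the free
group (`PiCancellationForms.piMul_injective`), but modulo relations the most one can ask is
`c ∈ relations`. Witness: `c := [∅] ∈ relations`, `c ≠ 0`. [folklore] -/
theorem not_lift_mem_imp_eq_zero :
    ¬ ∀ P : ∀ n : ℕ, IntegralRep n → IntegralRep (n + 2),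
      (∀ (n : ℕ) (r : IntegralRep n),
        (P n r).domain = {z : Fin (n + 2) → ℝ | z 0 ^ 2 + z 1 ^ 2 ≤ 1 ∧
            (fun i : Fin n => z i.succ.succ) ∈ r.domain} ∧
          (P n r).integrand = fun z => r.integrand (fun i : Fin n => z i.succ.succ)) →
      ∀ c : FormalRep,
        FreeAbelianGroup.lift (fun s : (Σ n, IntegralRep n) => of (P s.1 s.2)) c ∈ relations →
          c = 0 := by
  intro h
  obtain ⟨P, hP⟩ := exists_pinned
  exact of_ne_zero (IntegralRep.empty 0)
    (h P hP _ (lift_mem_relations_of_mem P hP (IntegralRep.of_empty_mem_relations)))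

/-- **Padding by a relation never cancels** (the `[π]`-slot must carry a class of non-zero VALUE):
for every family `P` whose members are all relations — e.g. the disc with integrand `0`, any null
padding, any padding `ρ × r` with `[ρ] ∈ relations` — the cancellation statement is FALSE
(witness `c := [π]`). This is the multiplier-side analogue of the refuted zero-integral kernels of
`BetaCancellationNegative.not_kernelCancellation_of_odd`. [folklore] -/
theorem noCancellation_of_padding_mem_relations {d : ℕ}
    (P : ∀ n : ℕ, IntegralRep n → IntegralRep (n + d))
    (hP : ∀ (n : ℕ) (r : IntegralRep n), of (P n r) ∈ relations) :
    ¬ ∀ c : FormalRep,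
      FreeAbelianGroup.lift (fun s : (Σ n, IntegralRep n) => of (P s.1 s.2)) c ∈ relations →
        c ∈ relations := by
  intro h
  have hmem : of piRep ∈ relations := h (of piRep) (lift_mem_relations_of_forall P hP _)
  have h0 : eval (of piRep) = 0 := relations_le_ker_eval_holds hmem
  rw [eval_of_piRep] at h0
  exact Real.pi_ne_zero h0

end Summit.KontsevichZagierPeriods.AyoubPiCancellationNegative

end
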